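import Summits.MatrixMultiplication.MatrixMultiplication.Theorems.SnSubsetDichotomyGlobalBranchStubBlockTruncation
import Summits.MatrixMultiplication.MatrixMultiplication.Theorems.SnSubsetDichotomyGlobalBranchStubBlockDictionary
import Summits.MatrixMultiplication.MatrixMultiplication.Theorems.SnSubsetDichotomyGlobalBranchStubPartitionNumerics

/-!
# Stub `stub_truncatedCount` (crux stmt-MatrixMultiplication-8303, line flat-tail-truncation)

Crux `Summit.MatrixMultiplication.MatrixMultiplication.Theses.SnSubsetDichotomy.GlobalBranch`, line
`flat-tail-truncation`: the **two-ended level-`L` truncation of the BCGPU identity for `𝔖ₙ` with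
spectral low weight** — the assembly of the three landed stubs `stub_blockTruncation` (the analytic
core over the Wedderburn blocks of any finite group), `stub_blockDictionary` (blocks of `ℂ[𝔖ₙ]` ↔
partitions of `n`) and `stub_partitionNumerics` (end shapes, `f^μ ≤ n^{(ℓ)}` at level `ℓ`).

For `n ≥ 1`, every `L`, every `D > 0` below all `f^μ = numStandardTableaux μ` of two-ended level
`n - max(μ₁, μ₁') > L`, and every triple `S, T, U ⊆ 𝔖ₙ` with the triple product property,
`V² ≤ n!·V + (n!)^{3/2}·V/√D + V²·Σ_{ℓ=1}^{L} n^{(ℓ)}·(sM ℓ S·sM ℓ T·sM ℓ U + sT ℓ S·sT ℓ T·sT ℓ U)`,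
`V = |S||T||U|`, where `sM ℓ X = |X|⁻² Σ_{μ ≠ (n), μ₁ = n-ℓ} Σ_{x,y∈X} Re χ^μ(x⁻¹y)` is the spectral
level-`ℓ` (row) mass of `X` and `sT` the column version (`μ₁' = n - ℓ`); `sM`, `sT` enter as
function parameters pinned by their defining equations (the skeleton instantiates them with its
`specMass`, `specMassT`).

Proof: take a unitary Wedderburn decomposition `φ` of `ℂ[𝔖ₙ]` (`exists_unitary_algEquiv_pi_matrix`)
and the bijection `part` of `stub_blockDictionary`; label block `i` by `0` if `part i = (n)`, by
`ℓ = n - μ₁ ∈ [1, L]` (row family), else by `L + (n - μ₁') ∈ [L+1, 2L]` (column family), else `0`.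
Label-`0` blocks are the two end shapes (`f = 1`) or have two-ended level `> L` (`D ≤ f`);
family blocks have `f ≤ n^{(ℓ)}` (`stub_partitionNumerics`); the Hilbert–Schmidt mass of a family
is a sub-sum of the character sums defining `sM`/`sT` (norm = character sum, `part` bijective, every
character sum is a norm hence `≥ 0`). `stub_blockTruncation` with `M = 2L` and a reindexing of the
second half of `Σ_{m=1}^{2L}` gives the claim.
-/

set_option linter.dupNamespace false

open scoped BigOperators Matrix ComplexOrder
open Finset
open Literature.Combinatorics.Additive (TripleProductProperty indicatorElem indicatorElemInv)
open Literature.NumberTheory.DiophantineGeometry (numStandardTableaux spechtCharacter)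
open Literature.RepresentationTheory.FiniteGroups (BlockAlgebraC blockRep)

namespace Summit.MatrixMultiplication.MatrixMultiplication.Theorems.GlobalBranch

open Literature.RepresentationTheory.FiniteGroups Literature.Barriers.MatrixMultiplication

section Assembly

variable {n : ℕ}

/-- `n - max a b > L` iff both `n - a > L` and `n - b > L`. [folklore] -/
theorem truncatedCount_lt_sub_max {L a b : ℕ} (ha : L < n - a) (hb : L < n - b) :
    L < n - max a b := by
  rcases le_total a b with h | h
  · rwa [max_eq_right h]
  · rwa [max_eq_left h]

/-- The largest part of the one-row partition `(n)` is `n`. [folklore] -/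
theorem truncatedCount_sup_indiscrete (hn : n ≠ 0) :
    (Nat.Partition.indiscrete n).parts.sup = n := by
  rw [Nat.Partition.indiscrete_parts hn, Multiset.sup_singleton]

/-- Reindexing a sum over partitions through a bijection from the blocks. [folklore] -/
theorem truncatedCount_sum_reindex {r : ℕ} (part : Fin r → Nat.Partition n)
    (hbij : Function.Bijective part) (P : Nat.Partition n → Prop) [DecidablePred P]
    (g : Nat.Partition n → ℝ) :
    ∑ μ ∈ univ.filter P, g μ = ∑ i ∈ univ.filter (fun i => P (part i)), g (part i) := by
  classical
  symm
  refine Finset.sum_bij (fun i _ => part i) (fun i hi => ?_) (fun i _ j _ h => hbij.1 h)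
    (fun μ hμ => ?_) (fun _ _ => rfl)
  · simpa using hi
  · obtain ⟨i, rfl⟩ := hbij.2 μ
    exact ⟨i, by simpa using hμ, rfl⟩

end Assembly

/-- **Two-ended level-`L` truncation of the BCGPU identity for `𝔖ₙ`** (stub `stub_truncatedCount`
of the line `flat-tail-truncation`): with `V = |S||T||U|` for a TPP triple in `𝔖ₙ`, `n ≥ 1`, and
`D > 0` below every `f^μ` of two-ended level `> L`,
`V² ≤ n! V + (n!)^{3/2} V/√D + V² Σ_{ℓ=1}^{L} n^{(ℓ)} (sM ℓ S sM ℓ T sM ℓ U + sT ℓ S sT ℓ T sT ℓ U)`,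
where `sM ℓ X = |X|⁻² Σ_{μ ≠ (n), μ₁ = n-ℓ} Σ_{x,y ∈ X} Re χ^μ(x⁻¹y)` and `sT` is the column version. -/
theorem stub_truncatedCount (n L : ℕ) (hn : 1 ≤ n) (D : ℝ) (hD : 0 < D)
    (hdim : ∀ μ : Nat.Partition n, L < n - max μ.parts.sup (Multiset.card μ.parts) →
      D ≤ (numStandardTableaux μ : ℝ))
    (sM sT : ℕ → Finset (Equiv.Perm (Fin n)) → ℝ)
    (hsM : ∀ (ℓ : ℕ) (X : Finset (Equiv.Perm (Fin n))), sM ℓ X =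
      (∑ μ ∈ univ.filter (fun μ : Nat.Partition n =>
          μ ≠ Nat.Partition.indiscrete n ∧ μ.parts.sup = n - ℓ),
        ∑ x ∈ X, ∑ y ∈ X, (spechtCharacter ℂ μ (x⁻¹ * y)).re) / ((X.card : ℝ) ^ 2))
    (hsT : ∀ (ℓ : ℕ) (X : Finset (Equiv.Perm (Fin n))), sT ℓ X =
      (∑ μ ∈ univ.filter (fun μ : Nat.Partition n =>
          μ ≠ Nat.Partition.indiscrete n ∧ Multiset.card μ.parts = n - ℓ),
        ∑ x ∈ X, ∑ y ∈ X, (spechtCharacter ℂ μ (x⁻¹ * y)).re) / ((X.card : ℝ) ^ 2))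
    (S T U : Finset (Equiv.Perm (Fin n))) (hTPP : TripleProductProperty S T U) :
    ((S.card * T.card * U.card : ℕ) : ℝ) ^ 2 ≤
      (n.factorial : ℝ) * ((S.card * T.card * U.card : ℕ) : ℝ) +
        (n.factorial : ℝ) ^ ((3 : ℝ) / 2) * ((S.card * T.card * U.card : ℕ) : ℝ) / Real.sqrt D +
        ((S.card * T.card * U.card : ℕ) : ℝ) ^ 2 *
          ∑ ℓ ∈ Finset.Ico 1 (L + 1), (n.descFactorial ℓ : ℝ) *
            (sM ℓ S * sM ℓ T * sM ℓ U + sT ℓ S * sT ℓ T * sT ℓ U) := by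
  classical
  have hn0 : n ≠ 0 := Nat.one_le_iff_ne_zero.1 hn
  -- a unitary Wedderburn decomposition and its dictionary
  obtain ⟨r, d, hd, φ, hφ⟩ := exists_unitary_algEquiv_pi_matrix (Equiv.Perm (Fin n))
  haveI : ∀ i, NeZero (d i) := hd
  obtain ⟨part, hbij, -, hdeg, -, hnorm⟩ := stub_blockDictionary n φ hφ
  -- character sums are non-negative (they are Hilbert–Schmidt norms)
  set cs : Nat.Partition n → Finset (Equiv.Perm (Fin n)) → ℝ :=
    fun μ X => ∑ x ∈ X, ∑ y ∈ X, (spechtCharacter ℂ μ (x⁻¹ * y)).re with hcs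
  have hcs_nonneg : ∀ μ X, 0 ≤ cs μ X := by
    intro μ X
    obtain ⟨i, rfl⟩ := hbij.2 μ
    rw [hcs]
    simp only
    rw [← hnorm i X]
    exact re_trace_conjTranspose_mul_self_nonneg _
  -- the labelling
  set lvR : Fin r → ℕ := fun i => n - (part i).parts.sup with hlvR
  set lvC : Fin r → ℕ := fun i => n - Multiset.card (part i).parts with hlvC
  set lab : Fin r → ℕ := fun i =>
    if part i = Nat.Partition.indiscrete n then 0
    else if 1 ≤ lvR i ∧ lvR i ≤ L then lvR i
    else if 1 ≤ lvC i ∧ lvC i ≤ L then L + lvC i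
    else 0 with hlab
  set N : ℕ → ℝ := fun m => if m ≤ L then (n.descFactorial m : ℝ) else (n.descFactorial (m - L) : ℝ)
    with hNdef
  set F : ℕ → Finset (Equiv.Perm (Fin n)) → ℝ := fun m X => if m ≤ L then sM m X else sT (m - L) X
    with hFdef
  -- elementary facts about the labelling
  have hlvRi : ∀ i, lvR i = n - (part i).parts.sup := fun i => rfl
  have hlvCi : ∀ i, lvC i = n - Multiset.card (part i).parts := fun i => rfl
  have lab_cases : ∀ i,
      (part i = Nat.Partition.indiscrete n ∧ lab i = 0) ∨
      (part i ≠ Nat.Partition.indiscrete n ∧ (1 ≤ lvR i ∧ lvR i ≤ L) ∧ lab i = lvR i) ∨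
      (part i ≠ Nat.Partition.indiscrete n ∧ ¬ (1 ≤ lvR i ∧ lvR i ≤ L) ∧
        (1 ≤ lvC i ∧ lvC i ≤ L) ∧ lab i = L + lvC i) ∨
      (part i ≠ Nat.Partition.indiscrete n ∧ ¬ (1 ≤ lvR i ∧ lvR i ≤ L) ∧
        ¬ (1 ≤ lvC i ∧ lvC i ≤ L) ∧ lab i = 0) := by
    intro i
    by_cases hind : part i = Nat.Partition.indiscrete n
    · exact Or.inl ⟨hind, by simp only [hlab, if_pos hind]⟩
    · by_cases h2 : 1 ≤ lvR i ∧ lvR i ≤ L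
      · exact Or.inr (Or.inl ⟨hind, h2, by simp only [hlab, if_neg hind, if_pos h2]⟩)
      · by_cases h3 : 1 ≤ lvC i ∧ lvC i ≤ L
        · exact Or.inr (Or.inr (Or.inl ⟨hind, h2, h3, by
            simp only [hlab, if_neg hind, if_neg h2, if_pos h3]⟩))
        · exact Or.inr (Or.inr (Or.inr ⟨hind, h2, h3, by
            simp only [hlab, if_neg hind, if_neg h2, if_neg h3]⟩))
  have hlab_le : ∀ i, lab i ≤ 2 * L := by
    intro i
    rcases lab_cases i with ⟨-, hl⟩ | ⟨-, h2, hl⟩ | ⟨-, -, h3, hl⟩ | ⟨-, -, -, hl⟩ <;>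
      rw [hl] <;> omega
  have h0 : ∀ i, lab i = 0 → d i = 1 ∨ D ≤ (d i : ℝ) := by
    intro i hi
    obtain ⟨hsup, hcard, hrow1, hcol1, -, -⟩ := stub_partitionNumerics n hn (part i)
    have hR := hlvRi i
    have hC := hlvCi i
    rcases lab_cases i with ⟨hind, -⟩ | ⟨-, h2, hl⟩ | ⟨-, -, h3, hl⟩ | ⟨-, h2, h3, -⟩
    · left
      rw [hdeg i, hind]
      exact partitionNumerics_eq_one_of_sup_eq _ (truncatedCount_sup_indiscrete hn0)
    · exfalso; rw [hl] at hi; omega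
    · exfalso; rw [hl] at hi; omega
    · by_cases hR0 : lvR i = 0
      · left
        rw [hdeg i]
        apply hrow1
        omega
      · by_cases hC0 : lvC i = 0
        · left
          rw [hdeg i]
          apply hcol1
          omega
        · right
          rw [hdeg i]
          apply hdim
          apply truncatedCount_lt_sub_max
          · rw [← hR]; omega
          · rw [← hC]; omega
  have hN0 : ∀ m, 0 ≤ N m := by
    intro m
    simp only [hNdef]
    split_ifs <;> exact Nat.cast_nonneg _
  have hNle : ∀ i, lab i ≠ 0 → (d i : ℝ) ≤ N (lab i) := by
    intro i hi
    obtain ⟨hsup, hcard, -, -, hrowℓ, hcolℓ⟩ := stub_partitionNumerics n hn (part i)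
    have hR := hlvRi i
    have hC := hlvCi i
    rcases lab_cases i with ⟨-, hl⟩ | ⟨-, h2, hl⟩ | ⟨-, -, h3, hl⟩ | ⟨-, -, -, hl⟩
    · exact (hi hl).elim
    · rw [hl, hNdef]
      simp only [if_pos h2.2, hdeg i]
      apply hrowℓ
      omega
    · rw [hl, hNdef]
      have hnot : ¬ (L + lvC i ≤ L) := by omega
      simp only [if_neg hnot, Nat.add_sub_cancel_left, hdeg i]
      apply hcolℓ
      omega
    · exact (hi hl).elim
  -- non-negativity of the masses
  have hsM_nonneg : ∀ ℓ X, 0 ≤ sM ℓ X := by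
    intro ℓ X
    rw [hsM]
    exact div_nonneg (Finset.sum_nonneg fun μ _ => hcs_nonneg μ X) (by positivity)
  have hsT_nonneg : ∀ ℓ X, 0 ≤ sT ℓ X := by
    intro ℓ X
    rw [hsT]
    exact div_nonneg (Finset.sum_nonneg fun μ _ => hcs_nonneg μ X) (by positivity)
  have hF0 : ∀ m X, 0 ≤ F m X := by
    intro m X
    simp only [hFdef]
    split_ifs
    · exact hsM_nonneg _ _
    · exact hsT_nonneg _ _
  -- the family masses are sub-sums of the character sums defining `sM` / `sT`
  have hmass : ∀ (P : Nat.Partition n → Prop) [DecidablePred P] (m : ℕ) (X : Finset (Equiv.Perm (Fin n))),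
      (∀ i, lab i = m → P (part i)) →
      ∑ i ∈ univ.filter (fun i => lab i = m),
          ((φ (indicatorElem ℂ X) i)ᴴ * φ (indicatorElem ℂ X) i).trace.re ≤
        (X.card : ℝ) ^ 2 * ((∑ μ ∈ univ.filter P, cs μ X) / ((X.card : ℝ) ^ 2)) := by
    intro P _ m X hP
    have hle : ∑ i ∈ univ.filter (fun i => lab i = m),
        ((φ (indicatorElem ℂ X) i)ᴴ * φ (indicatorElem ℂ X) i).trace.re ≤
          ∑ μ ∈ univ.filter P, cs μ X := by
      rw [truncatedCount_sum_reindex part hbij P (fun μ => cs μ X)]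
      have hrw : ∀ i, ((φ (indicatorElem ℂ X) i)ᴴ * φ (indicatorElem ℂ X) i).trace.re =
          cs (part i) X := fun i => by rw [hnorm i X]
      simp only [hrw]
      refine Finset.sum_le_sum_of_subset_of_nonneg ?_ (fun i _ _ => hcs_nonneg _ _)
      intro i hi
      simp only [Finset.mem_filter, Finset.mem_univ, true_and] at hi ⊢
      exact hP i hi
    by_cases hX : X.card = 0
    · have hX' : X = ∅ := Finset.card_eq_zero.1 hX
      subst hX'
      have hz : ∀ μ, cs μ ∅ = 0 := fun μ => by simp [hcs]
      simp only [hz, Finset.sum_const_zero] at hle ⊢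
      simpa using hle
    · have hXpos : (0 : ℝ) < (X.card : ℝ) ^ 2 := by positivity
      rwa [mul_div_cancel₀ _ hXpos.ne']
  have hF : ∀ m : ℕ, m ≠ 0 → ∀ X : Finset (Equiv.Perm (Fin n)),
      ∑ i ∈ univ.filter (fun i => lab i = m),
        ((φ (indicatorElem ℂ X) i)ᴴ * φ (indicatorElem ℂ X) i).trace.re ≤ (X.card : ℝ) ^ 2 * F m X := by
    intro m hm X
    by_cases hmL : m ≤ L
    · have hFm : F m X = sM m X := by simp only [hFdef, if_pos hmL]
      rw [hFm, hsM]
      refine hmass (fun μ => μ ≠ Nat.Partition.indiscrete n ∧ μ.parts.sup = n - m) m X ?_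
      intro i hi
      have hR := hlvRi i
      have hsup := partitionNumerics_sup_parts_le (part i)
      rcases lab_cases i with ⟨-, hl⟩ | ⟨hind, h2, hl⟩ | ⟨-, -, h3, hl⟩ | ⟨-, -, -, hl⟩
      · rw [hl] at hi; exact (hm hi.symm).elim
      · refine ⟨hind, ?_⟩
        rw [hl] at hi
        omega
      · rw [hl] at hi; omega
      · rw [hl] at hi; exact (hm hi.symm).elim
    · have hFm : F m X = sT (m - L) X := by simp only [hFdef, if_neg hmL]
      rw [hFm, hsT]
      refine hmass (fun μ => μ ≠ Nat.Partition.indiscrete n ∧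
        Multiset.card μ.parts = n - (m - L)) m X ?_
      intro i hi
      have hC := hlvCi i
      have hcard := partitionNumerics_card_parts_le (part i)
      rcases lab_cases i with ⟨-, hl⟩ | ⟨-, h2, hl⟩ | ⟨hind, -, h3, hl⟩ | ⟨-, -, -, hl⟩
      · rw [hl] at hi; exact (hm hi.symm).elim
      · rw [hl] at hi; omega
      · refine ⟨hind, ?_⟩
        rw [hl] at hi
        omega
      · rw [hl] at hi; exact (hm hi.symm).elim
  -- the block truncation
  have key := stub_blockTruncation φ hφ (2 * L) lab hlab_le D hD h0 N hN0 hNle F hF0 hF S T U hTPP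
  have hcard : (Fintype.card (Equiv.Perm (Fin n)) : ℝ) = (n.factorial : ℝ) := by
    rw [Fintype.card_perm, Fintype.card_fin]
  rw [hcard] at key
  -- reindex the family sum
  have hsum : ∑ m ∈ Finset.Ico 1 (2 * L + 1), N m * (F m S * F m T * F m U) =
      ∑ ℓ ∈ Finset.Ico 1 (L + 1), (n.descFactorial ℓ : ℝ) *
        (sM ℓ S * sM ℓ T * sM ℓ U + sT ℓ S * sT ℓ T * sT ℓ U) := by
    rw [← Finset.sum_Ico_consecutive _ (show 1 ≤ L + 1 by omega) (show L + 1 ≤ 2 * L + 1 by omega)]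
    have h1 : ∑ m ∈ Finset.Ico 1 (L + 1), N m * (F m S * F m T * F m U) =
        ∑ ℓ ∈ Finset.Ico 1 (L + 1), (n.descFactorial ℓ : ℝ) * (sM ℓ S * sM ℓ T * sM ℓ U) := by
      refine Finset.sum_congr rfl fun m hm => ?_
      have hmL : m ≤ L := by rw [Finset.mem_Ico] at hm; omega
      simp only [hNdef, hFdef, if_pos hmL]
    have h2 : ∑ m ∈ Finset.Ico (L + 1) (2 * L + 1), N m * (F m S * F m T * F m U) =
        ∑ ℓ ∈ Finset.Ico 1 (L + 1), (n.descFactorial ℓ : ℝ) * (sT ℓ S * sT ℓ T * sT ℓ U) := by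
      have e : Finset.Ico (L + 1) (2 * L + 1) = Finset.Ico (1 + L) (L + 1 + L) := by
        congr 1 <;> ring
      rw [e, ← Finset.sum_Ico_add']
      refine Finset.sum_congr rfl fun ℓ hℓ => ?_
      have hℓ1 : 1 ≤ ℓ := by rw [Finset.mem_Ico] at hℓ; omega
      have hnot : ¬ (ℓ + L ≤ L) := by omega
      simp only [hNdef, hFdef, if_neg hnot, Nat.add_sub_cancel]
    rw [h1, h2, ← Finset.sum_add_distrib]
    refine Finset.sum_congr rfl fun ℓ _ => ?_
    ring
  rw [hsum] at key
  exact key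

end Summit.MatrixMultiplication.MatrixMultiplication.Theorems.GlobalBranch
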